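import Literature.Geometry.DiscreteGeometry.UnitDiscContactNumber
import Mathlib.Tactic.IntervalCases
import HarnessLib

/-!
# Harborth's hexagonal spiral of discs: the lattice vocabulary

Topic `Literature/Geometry/DiscreteGeometry` (penny graphs / contact numbers), companion to
`UnitDiscContactNumber.lean` (named facts `Harborth1974_contactNumber`, `HeitmannRadin1980_groundStates`).
This file and its two sequels (`HexagonalSpiralContacts.lean`, `HarborthConstruction.lean`) PROVE
the attainment half of Harborth's theorem,

* H. Harborth, *Lösung zu Problem 664A*, Elem. Math. **29** (1974) 14–15, p. 15, (6): "Dass die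
  vermutete Maximalzahl angenommen wird, ist in den folgenden Lagerungen abzuzählen: An einen Kreis
  werde ein Kranz von 6, daran ein Kranz von 12, daran ein Kranz von 18 Kreisen, usw., angelagert.
  Bei vollständigen Kränzen bilden die Randpolygone reguläre Sechsecke. Jeder Kranz werde an einer
  Ecke begonnen und so aufgefüllt, dass jeder neue Kreis den vorherigen berührt. Mit `s ≥ 0`,
  `0 ≤ i ≤ 5`, `0 ≤ j ≤ s` werden dann bei `n = 3s² + 3s + 1 + (s+1)i + j` Kreisen
  `z = 9s² + 3s + (3s+2)i + 3j - 1` Berührpunkte gezählt, mit der Ausnahme `z = 9s² + 3s` im Falle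
  `i = j = 0`. Durch Einsetzen dieser Werte kann `B(n) ≥ z ≥ [3n - √(12n-3)]` (6) nachgeprüft
  werden." (= Heitmann–Radin 1980, §3, the configurations `C_v = H_s ∪ …` with `C_b = H(n)`, (2)),

i.e. for every `n` a packing of `n` unit discs with exactly `[3n - √(12n - 3)]` contacts. The upper
bound (5) (Euler's formula + peeling) is NOT proved in the tree and `Harborth1974_contactNumber`
stays a named fact; `HarborthConstruction.lean` reduces it to (5).

## This file: definitions (all real) and their basic API

Discs are labelled by `ℤ × ℤ` through the tree's `Theil2006.triPoint (m, n) = m b₁ + n b₂`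
(`A₂`, not re-declared; `normForm`/`Adj` below mirror the venture-side `latNorm`/`latContacts` of
`Summits/Ventures/Crystal3D/StickySpheres/SmallDiscValues.lean`, which a Literature file cannot
import). In these labels:

* `HarborthSpiral.normForm`, `Adj`, `nbrs`, `adjCount` — the norm form `m² + mn + n²`
  (`= ‖triPoint (m,n)‖²`), lattice adjacency (norm form of the difference `= 1`, i.e. touching
  discs), the six neighbours, the number of ORDERED adjacent pairs of a finite label set
  (`= 2 ×` contacts); `adjCount_insert`.
* `HarborthSpiral.Inside t`, `hexagon t` — the lattice hexagon `H_t` (`|m|, |n|, |m+n| ≤ t`,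
  `3t² + 3t + 1` labels); ring `r` = `H_r ∖ H_{r-1}` (`6r` labels).
* `HarborthSpiral.pos r`, `ringPoint r a` — Harborth's traversal of ring `r ≥ 1` as six charts
  (top row left → right starting with `(1-r, r)`, the label nestling at the corner `(1-r, r-1)`
  of the inner hexagon — "an einer Ecke begonnen" —, then clockwise), positions `0 ≤ a < 6r`,
  corners of ring `r` at `a ≡ r - 1 (mod r)`, the last one `(-r, r)` adjacent to the first label
  ("… so aufgefüllt, dass jeder neue Kreis den vorherigen berührt"); `pos` and `ringPoint` are
  mutually inverse on the ring (`ringPoint_spec`, `eq_ringPoint_of_pos`).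
* `HarborthSpiral.config r a = H_{r-1} ∪ {first a labels of ring r}` — Harborth's configuration with
  `n = 3r² - 3r + 1 + a` discs (`s = r - 1`, `a = (s+1)i + j`); `config_zero`, `config_succ`,
  `config_full`.
* `HarborthSpiral.ι`, `ringContacts r a = 3a - [a ≥ 1] - #{t ≤ 5 : t r ≤ a}` (`= (3s+2)i + 3j - 1`),
  `incr r a` (contacts gained by the `a`-th ring disc: `3 - [a = 0] - [corner of sides 1–5]`).

Design: everything is stated so that membership and position questions are LINEAR integer
arithmetic (`omega`) — no `|·|`, no division; `pos`/`ringPoint` are `if`-chains over the six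
charts. Nothing here is specific to maximality; the counting is in the sequels.
-/

noncomputable section

namespace Literature.Geometry.DiscreteGeometry

open Finset
open Literature.MathematicalPhysics.StatisticalMechanics

namespace HarborthSpiral

/-! ## Lattice adjacency in `ℤ²`-labels of `A₂` -/

/-- The norm form `m² + mn + n²` of `A₂`: `‖triPoint (m, n)‖² = m² + mn + n²`. [cite: HeitmannRadin1980, §3 (p. 283)] -/
def normForm (k : ℤ × ℤ) : ℤ := k.1 ^ 2 + k.1 * k.2 + k.2 ^ 2

/-- `q` is a lattice neighbour of `p`: the difference has norm form `1` (distance `1` in `A₂`). [cite: HeitmannRadin1980, §2 (p. 283)] -/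
def Adj (p q : ℤ × ℤ) : Prop := normForm (q - p) = 1

/-- Adjacency is decidable (an integer equation). [folklore] -/
instance : DecidableRel Adj := fun p q => inferInstanceAs (Decidable (normForm (q - p) = 1))

/-- The six lattice neighbours of a label. [cite: Theil2006, §2.3 Remark 2.5] -/
def nbrs (p : ℤ × ℤ) : Finset (ℤ × ℤ) :=
  {(p.1 + 1, p.2), (p.1 - 1, p.2), (p.1, p.2 + 1), (p.1, p.2 - 1), (p.1 + 1, p.2 - 1), (p.1 - 1, p.2 + 1)}

/-- `m² + mn + n² = 1` has exactly the six solutions `±(1,0), ±(0,1), ±(1,-1)`. [cite: Theil2006, §2.3 Remark 2.5] -/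
theorem normForm_eq_one_iff (m n : ℤ) :
    normForm (m, n) = 1 ↔ (m = 1 ∧ n = 0) ∨ (m = -1 ∧ n = 0) ∨ (m = 0 ∧ n = 1) ∨ (m = 0 ∧ n = -1) ∨
      (m = 1 ∧ n = -1) ∨ (m = -1 ∧ n = 1) := by
  constructor
  · intro h
    simp only [normForm] at h
    have h3 : 3 * n ^ 2 ≤ 4 := by nlinarith [sq_nonneg (2 * m + n)]
    have h3' : 3 * m ^ 2 ≤ 4 := by nlinarith [sq_nonneg (2 * n + m)]
    have hn : n ^ 2 ≤ 1 := by omega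
    have hm : m ^ 2 ≤ 1 := by omega
    rw [sq_le_one_iff_abs_le_one, abs_le] at hn hm
    obtain ⟨hn1, hn2⟩ := hn
    obtain ⟨hm1, hm2⟩ := hm
    interval_cases m <;> interval_cases n <;> omega
  · rintro (⟨rfl, rfl⟩ | ⟨rfl, rfl⟩ | ⟨rfl, rfl⟩ | ⟨rfl, rfl⟩ | ⟨rfl, rfl⟩ | ⟨rfl, rfl⟩) <;>
      simp [normForm]

/-- Adjacency is membership in the explicit six-point neighbourhood. [cite: Theil2006, §2.3 Remark 2.5] -/
theorem adj_iff_mem_nbrs (p q : ℤ × ℤ) : Adj p q ↔ q ∈ nbrs p := by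
  obtain ⟨a, b⟩ := p
  obtain ⟨c, d⟩ := q
  rw [Adj, Prod.mk_sub_mk, normForm_eq_one_iff]
  simp only [nbrs, mem_insert, mem_singleton, Prod.mk.injEq]
  omega

/-- Adjacency is symmetric. [cite: HeitmannRadin1980, §2 (p. 283)] -/
theorem adj_comm (p q : ℤ × ℤ) : Adj p q ↔ Adj q p := by
  simp only [Adj, normForm]
  obtain ⟨a, b⟩ := p
  obtain ⟨c, d⟩ := q
  simp only [Prod.mk_sub_mk]
  constructor <;> intro h <;> nlinarith [h]

/-- No label is adjacent to itself. [cite: HeitmannRadin1980, §2 (p. 283)] -/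
theorem not_adj_self (p : ℤ × ℤ) : ¬ Adj p p := by
  simp [Adj, normForm]

/-- The indicator of membership (a `ℕ`-valued plumbing function; `if_pos`/`if_neg` evaluate it). [folklore] -/
def ind (S : Finset (ℤ × ℤ)) (q : ℤ × ℤ) : ℕ := if q ∈ S then 1 else 0

/-- The number of neighbours of `p` inside `S`, as the sum of six indicators. [cite: Theil2006, §2.3 Remark 2.5] -/
theorem card_filter_adj (S : Finset (ℤ × ℤ)) (p : ℤ × ℤ) :
    (S.filter (Adj p)).card = ind S (p.1 + 1, p.2) + ind S (p.1 - 1, p.2) + ind S (p.1, p.2 + 1) +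
      ind S (p.1, p.2 - 1) + ind S (p.1 + 1, p.2 - 1) + ind S (p.1 - 1, p.2 + 1) := by
  have h1 : S.filter (Adj p) = (nbrs p).filter (· ∈ S) := by
    ext q
    simp only [mem_filter, adj_iff_mem_nbrs]
    tauto
  rw [h1, card_filter, nbrs]
  rw [sum_insert, sum_insert, sum_insert, sum_insert, sum_insert, sum_singleton]
  · simp only [ind, add_assoc]
  all_goals simp only [mem_insert, mem_singleton, Prod.mk.injEq, not_or]; omega

/-- Ordered adjacent pairs inside `S` (twice the number of contacts). [cite: HeitmannRadin1980, §2 (p. 283)] -/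
def adjCount (S : Finset (ℤ × ℤ)) : ℕ := ∑ q ∈ S, (S.filter (Adj q)).card

/-- Adding a new label adds twice its number of neighbours in `S`. [cite: Harborth1974, p. 15] -/
theorem adjCount_insert {S : Finset (ℤ × ℤ)} {p : ℤ × ℤ} (hp : p ∉ S) :
    adjCount (insert p S) = adjCount S + 2 * (S.filter (Adj p)).card := by
  unfold adjCount
  rw [sum_insert hp]
  have h0 : (insert p S).filter (Adj p) = S.filter (Adj p) := by
    rw [filter_insert, if_neg (not_adj_self p)]
  have h1 : ∀ q ∈ S, ((insert p S).filter (Adj q)).card =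
      (S.filter (Adj q)).card + (if Adj p q then 1 else 0) := by
    intro q hq
    rw [filter_insert]
    by_cases h : Adj q p
    · rw [if_pos h, card_insert_of_notMem (fun h' => hp (mem_filter.1 h').1), if_pos ((adj_comm _ _).1 h)]
    · rw [if_neg h, if_neg (fun h' => h ((adj_comm _ _).1 h')), add_zero]
  rw [h0, sum_congr rfl h1, sum_add_distrib, ← card_filter]
  ring

/-! ## The hexagonal spiral: hexagons, rings, charts -/

/-- `q` lies in the lattice hexagon of (hexagonal) radius `t` about the origin:
`|m| ≤ t`, `|n| ≤ t`, `|m + n| ≤ t` (written without `|·|`). [cite: HeitmannRadin1980, §3] -/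
def Inside (t : ℤ) (q : ℤ × ℤ) : Prop :=
  -t ≤ q.1 ∧ q.1 ≤ t ∧ -t ≤ q.2 ∧ q.2 ≤ t ∧ -t ≤ q.1 + q.2 ∧ q.1 + q.2 ≤ t

/-- Membership in a hexagon is decidable (six integer inequalities). [folklore] -/
instance (t : ℤ) : DecidablePred (Inside t) := fun q => by unfold Inside; infer_instance

/-- The hexagon `H_t` (`3t² + 3t + 1` labels; Heitmann–Radin's `H_s`). [cite: HeitmannRadin1980, §3] -/
def hexagon (t : ℕ) : Finset (ℤ × ℤ) :=
  ((Icc (-(t : ℤ)) t) ×ˢ (Icc (-(t : ℤ)) t)).filter (Inside t)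

/-- Membership in `H_t` is the three inequalities `|m|, |n|, |m+n| ≤ t`. [cite: HeitmannRadin1980, §3 (p. 283)] -/
theorem mem_hexagon {t : ℕ} {q : ℤ × ℤ} : q ∈ hexagon t ↔ Inside t q := by
  simp only [hexagon, mem_filter, mem_product, mem_Icc, Inside]
  omega

/-- Position `0 ≤ pos < 6r` of a label of ring `r ≥ 1` along Harborth's traversal (six charts:
top row left→right starting next to the corner `(-r, r)`, then clockwise… ; corners at positions
`≡ r - 1 (mod r)`, the last one `(-r, r)` adjacent to the first point). Junk off the ring. [cite: Harborth1974, p. 15] -/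
def pos (r : ℤ) (q : ℤ × ℤ) : ℤ :=
  if q.2 = r ∧ 1 - r ≤ q.1 ∧ q.1 ≤ 0 then q.1 + r - 1
  else if 1 ≤ q.1 ∧ 0 ≤ q.2 ∧ q.1 + q.2 = r then r - 1 + q.1
  else if q.1 = r ∧ -r ≤ q.2 ∧ q.2 ≤ -1 then 2 * r - 1 - q.2
  else if q.2 = -r ∧ 0 ≤ q.1 ∧ q.1 ≤ r - 1 then 4 * r - 1 - q.1
  else if q.1 + q.2 = -r ∧ -r ≤ q.1 ∧ q.1 ≤ -1 then 4 * r - 1 - q.1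
  else if q.1 = -r ∧ 1 ≤ q.2 ∧ q.2 ≤ r then 5 * r - 1 + q.2
  else 0

/-- The label at position `a` of ring `r` (inverse of `pos`). [cite: Harborth1974, p. 15] -/
def ringPoint (r a : ℤ) : ℤ × ℤ :=
  if a ≤ r - 1 then (a - r + 1, r)
  else if a ≤ 2 * r - 1 then (a - r + 1, 2 * r - 1 - a)
  else if a ≤ 3 * r - 1 then (r, 2 * r - 1 - a)
  else if a ≤ 4 * r - 1 then (4 * r - 1 - a, -r)
  else if a ≤ 5 * r - 1 then (4 * r - 1 - a, a - 5 * r + 1)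
  else (-r, a - 5 * r + 1)

/-- Harborth's configuration with `3r² - 3r + 1 + a` discs (`r ≥ 1`, `0 ≤ a ≤ 6r`): the hexagon
`H_{r-1}` together with the first `a` labels of ring `r`. [cite: Harborth1974, p. 15] -/
def config (r a : ℕ) : Finset (ℤ × ℤ) :=
  (hexagon r).filter fun q => Inside ((r : ℤ) - 1) q ∨ pos r q < a

/-- A label is placed in `config r a` iff it lies in `H_{r-1}` or on ring `r` at a position `< a`.
[cite: Harborth1974, p. 15] -/
theorem mem_config {r a : ℕ} {q : ℤ × ℤ} :
    q ∈ config r a ↔ Inside ((r : ℤ) - 1) q ∨ (Inside r q ∧ pos r q < a) := by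
  rw [config, mem_filter, mem_hexagon]
  constructor
  · rintro ⟨h1, h2 | h2⟩
    · exact Or.inl h2
    · exact Or.inr ⟨h1, h2⟩
  · rintro (h | ⟨h1, h2⟩)
    · refine ⟨?_, Or.inl h⟩
      simp only [Inside] at h ⊢
      omega
    · exact ⟨h1, Or.inr h2⟩

/-- The positions of ring `r` lie in `[0, 6r)`. [cite: Harborth1974, p. 15] -/
theorem pos_nonneg_lt {r : ℤ} (hr : 1 ≤ r) {q : ℤ × ℤ} (h1 : Inside r q) (h2 : ¬ Inside (r - 1) q) :
    0 ≤ pos r q ∧ pos r q < 6 * r := by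
  obtain ⟨m, n⟩ := q
  simp only [Inside, pos] at *
  split_ifs <;> omega

/-- `ringPoint r a` lies on ring `r` at position `a`. [cite: Harborth1974, p. 15] -/
theorem ringPoint_spec {r a : ℤ} (hr : 1 ≤ r) (ha : 0 ≤ a) (ha' : a < 6 * r) :
    Inside r (ringPoint r a) ∧ ¬ Inside (r - 1) (ringPoint r a) ∧ pos r (ringPoint r a) = a := by
  unfold ringPoint
  split_ifs <;> simp only [Inside, pos, true_and] <;> split_ifs <;> omega

/-- `pos` is injective on ring `r`. [cite: Harborth1974, p. 15] -/
theorem eq_ringPoint_of_pos {r : ℤ} (hr : 1 ≤ r) {q : ℤ × ℤ} (h1 : Inside r q)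
    (h2 : ¬ Inside (r - 1) q) : q = ringPoint r (pos r q) := by
  obtain ⟨m, n⟩ := q
  simp only [Inside] at h1 h2
  generalize hp : pos r (m, n) = b
  simp only [pos] at hp
  split_ifs at hp <;> simp only [ringPoint] <;> split_ifs <;> simp only [Prod.mk.injEq] <;> omega

/-- `config r 0 = H_{r-1}`. [cite: Harborth1974, p. 15] -/
theorem config_zero {r : ℕ} (hr : 1 ≤ r) : config r 0 = hexagon (r - 1) := by
  ext q
  rw [mem_config, mem_hexagon, Nat.cast_sub hr, Nat.cast_one]
  constructor
  · rintro (h | ⟨h1, h2⟩)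
    · exact h
    · by_cases h3 : Inside ((r : ℤ) - 1) q
      · exact h3
      · have := (pos_nonneg_lt (by exact_mod_cast hr) h1 h3).1
        simp at h2
        omega
  · exact fun h => Or.inl h

/-- `config r (6r) = H_r`. [cite: Harborth1974, p. 15] -/
theorem config_full {r : ℕ} (hr : 1 ≤ r) : config r (6 * r) = hexagon r := by
  ext q
  rw [mem_config, mem_hexagon]
  constructor
  · rintro (h | ⟨h1, _⟩)
    · simp only [Inside] at h ⊢
      omega
    · exact h1
  · intro h1
    by_cases h3 : Inside ((r : ℤ) - 1) q
    · exact Or.inl h3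
    · refine Or.inr ⟨h1, ?_⟩
      have := (pos_nonneg_lt (by exact_mod_cast hr) h1 h3).2
      push_cast
      omega

/-- One more ring label: `config r (a+1) = insert (ringPoint r a) (config r a)` for `a < 6r`. [cite: Harborth1974, p. 15] -/
theorem config_succ {r a : ℕ} (hr : 1 ≤ r) (ha : a < 6 * r) :
    config r (a + 1) = insert (ringPoint r a) (config r a) := by
  have hr' : (1 : ℤ) ≤ r := by exact_mod_cast hr
  obtain ⟨s1, s2, s3⟩ := ringPoint_spec hr' (show (0 : ℤ) ≤ a by positivity)
    (show (a : ℤ) < 6 * r by exact_mod_cast ha)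
  ext q
  rw [mem_insert, mem_config, mem_config]
  push_cast
  constructor
  · rintro (h | ⟨h1, h2⟩)
    · exact Or.inr (Or.inl h)
    · by_cases h3 : Inside ((r : ℤ) - 1) q
      · exact Or.inr (Or.inl h3)
      · by_cases h4 : pos r q < a
        · exact Or.inr (Or.inr ⟨h1, h4⟩)
        · left
          have h5 : pos r q = a := by omega
          rw [eq_ringPoint_of_pos hr' h1 h3, h5]
  · rintro (rfl | h | ⟨h1, h2⟩)
    · exact Or.inr ⟨s1, by omega⟩
    · exact Or.inl h
    · exact Or.inr ⟨h1, by omega⟩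

/-- The new label is indeed new. [cite: Harborth1974, p. 15] -/
theorem ringPoint_not_mem_config {r a : ℕ} (hr : 1 ≤ r) (ha : a < 6 * r) :
    ringPoint r a ∉ config r a := by
  have hr' : (1 : ℤ) ≤ r := by exact_mod_cast hr
  obtain ⟨s1, s2, s3⟩ := ringPoint_spec hr' (show (0 : ℤ) ≤ a by positivity)
    (show (a : ℤ) < 6 * r by exact_mod_cast ha)
  rw [mem_config]
  rintro (h | ⟨_, h⟩)
  · exact s2 h
  · omega

/-- `H_0 = {0}`. [cite: HeitmannRadin1980, §3 (p. 283)] -/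
theorem hexagon_zero : hexagon 0 = {(0, 0)} := by
  ext ⟨m, n⟩
  rw [mem_hexagon, mem_singleton, Inside, Prod.mk.injEq]
  push_cast
  omega

/-! ## Counting: Harborth's numbers `9s² + 3s + (3s+2)k + 3j - 1` -/

/-- Indicator of `c ≤ a` (as an integer). [folklore] -/
def ι (c a : ℕ) : ℤ := if c ≤ a then 1 else 0

/-- Contacts gained by the first `a` labels of ring `r` (among themselves and with `H_{r-1}`):
`3a - [a ≥ 1] - #{t ∈ {1,…,5} : t r ≤ a}`; with `a = k r + j` (`0 ≤ j < r`) and `s = r - 1` this is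
Harborth's `(3s+2)k + 3j - 1` (and `0` for `a = 0`). [cite: Harborth1974, p. 15] -/
def ringContacts (r a : ℕ) : ℤ :=
  3 * a - (ι 1 a + ι r a + ι (2 * r) a + ι (3 * r) a + ι (4 * r) a + ι (5 * r) a)

/-- Contacts gained by placing the label at position `a` of ring `r`: `3`, minus one for the very
first label of the ring, minus one at the corners closing sides 1–5. [cite: Harborth1974, p. 15] -/
def incr (r a : ℕ) : ℤ :=
  3 - (if a = 0 then 1 else 0) -
    (if a + 1 = r ∨ a + 1 = 2 * r ∨ a + 1 = 3 * r ∨ a + 1 = 4 * r ∨ a + 1 = 5 * r then 1 else 0)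

end HarborthSpiral

end Literature.Geometry.DiscreteGeometry

end
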